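import Summits.BirchSwinnertonDyer.Rank1Residual.Supersingular.HeegnerIndexRecordsNonSurj
import Summits.BirchSwinnertonDyer.Rank1Residual.X10.JetchevTamagawaRecords
import HarnessLib

/-!
# Leaf X8 (`p = 3` good supersingular, `a_3 = ±3`), print-tier cell `bsd-print-x8` — two-engine HEEGNER-INDEX rows of the
# rank-`0` small-image cells (image `N_ns⁺(3)`): the record schema `HIRow` (one Heegner field `K = ℚ(√D)`, the twist `F = E^D`
# with the rational point both engines used, the index `m = [E(K) : ℤy_K]` in Miller's normalisation on two engines, the
# per-prime Tamagawa numbers) and its in-kernel recheck — the rows of DOSSIER v1.4 §5 item 11 (tiers H0/H1/H2/H3)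

HONEST FRAMING (cell `bsd-print-x8`, run/shared/lean/pub/bsd-print-x8/, D-0131 (2) PRINT TIER, typer seat ty3; leaf
`Rank1Residual.ClassX8 W p := p = 3 ∧ GoodSS W 3 ∧ a_3 ≠ 0` of `CornersAll` §1b): the leaf counts only when its CLASS THEOREM
is in the kernel BY NAME, flag-free (PARTITION currency, D-0132). This file books nothing, is not a class theorem, introduces
no named fact and asserts nothing about elliptic curves; DATA records + a decidable recheck, in the pattern and with the helper
functions of cell `b2b-bsdres`'s `Supersingular/HeegnerIndexRecordsNonSurj.lean` (harvest-1 GEN 22: the UNIT-quotient rows,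
`Row`, `ord_p m = 0`) and `Supersingular/HeegnerIndexTamagawaRecordsNonSurj.lean` (x10b gen 16: the Miller–Jetchev shape
`MJRow`, hard-wired to `p ≥ 5`, class X7, `ord_p m = 1`). Neither schema admits the rank-`0` small-image X8 cells of this cell
beyond the unit quotient: here `p = 3`, the curves are NOT semistable, and on 58 of the 60 rank-`0` cells `3 ∣ ∏c_q` or
`3 ∣ #Ш_an` (tiers H1 37 · H2 6 · H3 15 of lit's DOSSIER T14 (e); H0 = the two unit cells `135200bx1`, `442225bz1`). `HIRow`
is the common shape: it records the index datum WITHOUT prescribing `ord₃ m`, and carries the tier and, when it exists, the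
Jetchev–Miller prime `jmPrime = q ∣ N` with `ord₃ c_q(E) ≥ ord₃ m` — the certificate currency of the EXISTING kernel consumers
(TY2-DISCHARGE-TABLE §F; lit DOSSIER §5 item 8): H0 (`ord₃ m = 0`) → `Supersingular.X8.bsdp_of_matarNekovar_of_not_dvd_index`
/ `X8.bsdp_of_cha_of_not_dvd_index`; H1 (`ord₃ #Ш_an = 0`, `ord₃ m ≤ ord₃ c_q` at ONE `q`) →
`Supersingular.X8.bsdp_of_millerJetchev_of_index_le_tamagawa` (`JetchevIndexRoute.lean`; Miller 2011 Thm. 5.4 in Cha's case,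
flag `Miller11-Thm54-Cha-case`; `¬CM` by `ClassX8.not_hasCM`, `3 ∤ d_K` rechecked here); H2 (`3 ∣ #Ш_an`) →
`missingUpperBoundAt_of_matarNekovar_of_index_le` (upper bound `ord₃ #Ш ≤ 2·ord₃ m`, to be paired with a descent lower bound);
H3 (two Tamagawa numbers divisible by `3`): no printed consumer (the row is a datum). Per pair every one of these cells is
ALREADY a flag-free tree theorem by exact `3`-Selmer certificates (`bsdp3_nn_<label>`, cell bsd-ssimc) except `116032by1`,
`288800cu1` (lit T14); the value of these rows is the BY-NAME print derivation of the upper half and the anticyclotomic doors of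
p4 / k3-c5, not a census move. PARTITION: 0 cells.

## What an `HIRow` records and what the kernel rechecks (`HIRow.consistent`)

For the cell `label` (Cremona curve 1, minimal model `ainvs`, conductor `N` with factorisation, `#E(ℚ)_tors`, the per-prime
Tamagawa numbers `tamPrimes = [(q, c_q)]` (Cremona = PARI = engine 2's own Tate algorithm), `#Ш_an`): a Heegner field
`K = ℚ(√D)` (`D ≤ −7` fundamental, `3 ∤ D`, `(D, N) = 1`, every prime of `N` split — witness `hw² ≡ D (mod 4N)`), the minimal
model `Fainvs` of the twist `F = E^D` with `N_F = N·D²` and a twist witness `tw` (`j(F) = j(E)`, `c₆(F)c₄(E)c₄(F)c₆(E)·D = tw²`),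
the point `P = (X/d², Y/d³) ∈ F(ℚ)` both engines used (ON THE CURVE, rechecked exactly), and the two engines' index
`m₁ = m₂ = m = √(4ρ)`, `ρ = ĥ(y_K)/ĥ(P)` (Gross–Zagier–Zhang in Miller's normalisation; ENGINE 1 = harvest-1 GEN-22 `main.py`
sha256 `69e29ec7…` with its field-selection driver `87c3b840…`, cypari2; ENGINE 2 = `run_cert.py` `1b54bb20…` / `e2lib.py`
`6701e05d…` / `tate_stdlib.py` `ed9e5fd9…`, stdlib python — VERBATIM copies; kit job ids in `engines`), `v₁ = v₂ = ord₃ m`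
(RECOMPUTED `vp`), engine 2's `3`-saturation witness prime (informational), the tier and `jmPrime`. RECHECKED: list lengths,
`factorsOK`, `3 ∤ N`, `3 ∤ Δ(ainvs)`, `a_3 = ±3` by point count (`apCount`), non-CM, the field conditions, `3 ∤ #E(ℚ)_tors`,
the Tamagawa list (primes = primes of `N`, product = `tam`), `N_F = N·D²`, the twist witness, `P ∈ F(ℚ)`, `m₁ = m₂ ≥ 1`,
`v₁ = v₂ = vp 3 m₁`, the TIER from the data (`H0`: `3 ∤ #Ш_an·∏c_q`; `H1`: `3 ∤ #Ш_an` and exactly one `q` with `3 ∣ c_q`;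
`H2`: `3 ∣ #Ш_an` and at most one such `q`; `H3`: `3 ∤ #Ш_an` and at least two such `q`), and `jmPrime`: either `0`, or a prime
of `N` with `3 ∤ #Ш_an` and `vp 3 c_{jmPrime} ≥ v₁`. NOT rechecked (engine work / Cremona data): `L(E,1)`, `L'(F,1)`, periods,
heights, saturation, `E(K)[3] = 0`, the Tamagawa numbers themselves, `#Ш_an`, `#E(ℚ)_tors`.

References: [Miller2011LMS] Thm. 4.1, Cor. 4.8, Thm. 5.4; [Cha2005] Thm. 21; [MatarNekovar2019] Thm. 0.3 / 6.7 (1);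
[GrossZagier1986] I (6.5); [Cremona2006]; cell b2b-bsdres `HOME/b2b-bsdres-harvest-1/g22/ssr0nn/README.md` (recipe).
-/

set_option autoImplicit false

namespace Summit.BirchSwinnertonDyer.Rank1Residual.PrintX8

open Summit.BirchSwinnertonDyer.BirchSwinnertonDyer.Rank1Residual.HeegnerIndexRecords
  (vp discr c4 factorsOK isPrimeTD notCM weierstrassEvalZ)
open Summit.BirchSwinnertonDyer.Rank1Residual.AdditivePotMult.HeegnerIndexRecords (c6 isFundDiscNeg)
open Summit.BirchSwinnertonDyer.Rank1Residual.Supersingular.HeegnerIndexRecordsNonSurj (apCount)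
open Summit.BirchSwinnertonDyer.Rank1Residual.X10.JetchevTamagawaRecords (tamAt)

/-- One two-engine Heegner-index row of a rank-`0` small-image X8 cell at `p = 3` (module docstring). Asserts nothing;
`HIRow.consistent` is its decidable recheck. [folklore] -/
structure HIRow where
  /-- Cremona label (curve 1 of its class). -/
  label : String
  /-- a-invariants of the reduced minimal model of `E`. -/
  ainvs : List ℤ
  /-- conductor. -/
  N : ℕ
  /-- factorisation of `N`. -/
  Nfactors : List (ℕ × ℕ)
  /-- `#E(ℚ)_tors`. -/
  tors : ℕ
  /-- `(q, c_q)` for every prime `q ∣ N`, increasing. -/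
  tamPrimes : List (ℕ × ℕ)
  /-- `∏ c_q`. -/
  tam : ℕ
  /-- `#Ш_an`. -/
  shaAn : ℕ
  /-- tier `"H0" | "H1" | "H2" | "H3"` (rechecked from `shaAn`, `tamPrimes`). -/
  tier : String
  /-- the Heegner discriminant `D ≤ −7` (`3 ∤ D`). -/
  D : ℤ
  /-- factorisation of `|D|`. -/
  Dfactors : List (ℕ × ℕ)
  /-- `hw² ≡ D (mod 4N)`. -/
  hw : ℕ
  /-- minimal model of `F = E^D`. -/
  Fainvs : List ℤ
  /-- conductor of `F` (`= N·D²`). -/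
  NF : ℕ
  /-- twist witness. -/
  tw : ℕ
  /-- `P = (PX/Pd², PY/Pd³) ∈ F(ℚ)`, the point both engines used. -/
  PX : ℤ
  /-- see `PX`. -/
  PY : ℤ
  /-- see `PX`. -/
  Pd : ℕ
  /-- engine 1: `m = [E(K) : ℤ y_K]` (Miller's normalisation). -/
  m1 : ℕ
  /-- engine 1: `ord₃ m`. -/
  v1 : ℕ
  /-- engine 2: `m`. -/
  m2 : ℕ
  /-- engine 2: `ord₃ m`. -/
  v2 : ℕ
  /-- engine 2's `3`-saturation witness prime for `P` (informational). -/
  satWitness : ℕ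
  /-- a prime `q ∣ N` with `3 ∤ #Ш_an` and `ord₃ c_q ≥ ord₃ m` (Jetchev–Miller certificate), or `0`. -/
  jmPrime : ℕ
  /-- provenance (kit job ids); documentation only. -/
  engines : List String

namespace HIRow

variable (r : HIRow)

/-- `F` is the `D`-twist of `E`: `j(F) = j(E)` and `c₆(F)c₄(E)c₄(F)c₆(E)·D = tw² ≠ 0`. [folklore] -/
def twistOK : Bool :=
  (c4 r.Fainvs ^ 3 * discr r.ainvs == c4 r.ainvs ^ 3 * discr r.Fainvs) &&
  decide (0 < r.tw) && ((c6 r.Fainvs * c4 r.ainvs * c4 r.Fainvs * c6 r.ainvs * r.D) == (r.tw : ℤ) ^ 2)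

/-- Number of bad primes `q` with `3 ∣ c_q`. [folklore] -/
def nTam3 : ℕ := (r.tamPrimes.filter fun qc => qc.2 % 3 == 0).length

/-- The tier read off the data (module docstring). [folklore] -/
def tierOfData : String :=
  if vp 3 r.shaAn == 0 then (if r.nTam3 == 0 then "H0" else if r.nTam3 == 1 then "H1" else "H3")
  else (if r.nTam3 ≤ 1 then "H2" else "H3")

/-- Leaf / cell bits: five a-invariants, `N` factored, `3 ∤ N`, `3 ∤ Δ`, `a_3 = ±3` by point count, non-CM, `3 ∤ #tors`,
`#Ш_an ≥ 1`, Tamagawa list over the primes of `N` with product `tam`. [folklore] -/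
def checkCell : Bool :=
  (r.ainvs.length == 5) && factorsOK r.N r.Nfactors && (r.N % 3 != 0) && (discr r.ainvs % 3 != 0) &&
  (apCount r.ainvs 3 == 3 || apCount r.ainvs 3 == -3) && notCM r.ainvs && (r.tors % 3 != 0) && decide (1 ≤ r.shaAn) &&
  (r.tamPrimes.map Prod.fst == r.Nfactors.map Prod.fst) && (r.tamPrimes.foldl (fun acc qc => acc * qc.2) 1 == r.tam) &&
  (r.tier == r.tierOfData)

/-- The Heegner field and the twist: `D ≤ −7` fundamental, `3 ∤ D`, `(D, N) = 1`, `hw² ≡ D (mod 4N)`, `N_F = N·D²`, twist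
witness, `P ∈ F(ℚ)` exactly. [folklore] -/
def checkField : Bool :=
  (r.Fainvs.length == 5) && decide (r.D ≤ -7) && (r.D % 3 != 0) && (Int.gcd r.D r.N == 1) && isFundDiscNeg r.D r.Dfactors &&
  ((((r.hw : ℤ) ^ 2 - r.D) % (4 * (r.N : ℤ))) == 0) && (r.NF == r.N * r.D.natAbs * r.D.natAbs) && r.twistOK &&
  decide (1 ≤ r.Pd) && (weierstrassEvalZ r.Fainvs r.PX r.PY r.Pd == 0)

/-- The index datum: `m₁ = m₂ ≥ 1`, `v₁ = v₂ = ord₃ m₁` (recomputed); `jmPrime` is `0` or a Jetchev–Miller prime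
(`3 ∤ #Ш_an`, `q ∣ N`, `ord₃ c_q ≥ ord₃ m`). [folklore] -/
def checkIndex : Bool :=
  (r.m1 == r.m2) && decide (1 ≤ r.m1) && (r.v1 == vp 3 r.m1) && (r.v2 == r.v1) &&
  ((r.jmPrime == 0) ||
    ((vp 3 r.shaAn == 0) && r.Nfactors.any (fun qe => qe.1 == r.jmPrime) && decide (r.v1 ≤ vp 3 (tamAt r.tamPrimes r.jmPrime))))

/-- The full recheck of a row. [folklore] -/
def consistent : Bool := r.checkCell && r.checkField && r.checkIndex

/-- The Matar–Nekovář `k`-bound is usable at this row: `2·ord₃ m ≤ ord₃ #Ш_an` (then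
`missingUpperBoundAt_of_matarNekovar_of_index_le` with `k = ord₃ m` gives the UPPER half `ord₃ #Ш ≤ ord₃ #Ш_an`; informational,
not part of `consistent`). [cite: MatarNekovar2019, Thm. 0.3 (p. 456)] -/
def mnUsable : Bool := decide (2 * r.v1 ≤ vp 3 r.shaAn)

/-- The Jetchev–Miller certificate is present at this row (`jmPrime ≠ 0`; informational). [cite: Miller2011LMS, Thm. 5.4] -/
def jmUsable : Bool := r.jmPrime != 0

end HIRow

/-- A list of rows is `CertifiedHI` when every row is consistent (the statement of each data theorem of the files
`CertificateHeegnerIndexRecords*.lean`, proved by `decide`). [folklore] -/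
abbrev CertifiedHI (rs : List HIRow) : Prop := rs.all HIRow.consistent = true

/-- Unpacking `CertifiedHI`. [folklore] -/
theorem CertifiedHI.consistent_of_mem {rs : List HIRow} (h : CertifiedHI rs) {r : HIRow} (hr : r ∈ rs) :
    r.consistent = true :=
  List.all_eq_true.1 h r hr

/-- A consistent row with `jmPrime ≠ 0` carries the Jetchev–Miller inequality `ord₃ m ≤ ord₃ c_{jmPrime}` and `3 ∤ #Ш_an` on its
data. [cite: Miller2011LMS, Thm. 5.4] -/
theorem HIRow.jm_of_consistent (r : HIRow) (h : r.consistent = true) (hq : r.jmPrime ≠ 0) :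
    vp 3 r.shaAn = 0 ∧ r.v1 = vp 3 r.m1 ∧ r.v1 ≤ vp 3 (tamAt r.tamPrimes r.jmPrime) := by
  simp only [HIRow.consistent, HIRow.checkIndex, Bool.and_eq_true, Bool.or_eq_true, beq_iff_eq, decide_eq_true_eq] at h
  obtain ⟨-, ⟨⟨⟨-, -⟩, hv⟩, -⟩, hj⟩ := h
  rcases hj with hj | ⟨⟨hs, -⟩, hle⟩
  · exact absurd hj hq
  · exact ⟨hs, hv, hle⟩

-- `isPrimeTD` (trial division) on the larger prime factors of `N`/`D` needs a deeper recursion limit during `decide`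
-- (precedent: `Supersingular/HeegnerIndexRecordsNonSurjThreeX8A.lean`).
set_option maxRecDepth 100000 in
/-- **Sample: the harvest-1 GEN-22 unit-quotient X8 row `17600ca1` (image `3Nn`, `N < 2·10⁴` — a window pair, not one of this
cell's 61 census cells) transcribed into this schema** (`D = −1559`, `m = 2` on both engines, `ord₃ m = 0`, tier H0, no
Jetchev–Miller prime needed: `jmPrime = 0`), CONSISTENT — shows the schema accepts GEN-22's `Row`s; this cell's rows are in
`CertificateHeegnerIndexRecords*.lean`. [folklore] -/
theorem certifiedHI_sample : CertifiedHI [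
  { label := "17600ca1", ainvs := [0, 0, 0, 50, 1750], N := 17600, Nfactors := [(2, 6), (5, 2), (11, 1)], tors := 1,
    tamPrimes := [(2, 1), (5, 1), (11, 1)], tam := 1, shaAn := 1, tier := "H0",
    D := (-1559), Dfactors := [(1559, 1)], hw := 54829, Fainvs := [0, 0, 0, 121524050, (-6630959788250)], NF := 42776465600,
    tw := 13749958216915200000, PX := 113877452769, PY := 38429075626964447, Pd := 202, m1 := 2, v1 := 0, m2 := 2, v2 := 0,
    satWitness := 47, jmPrime := 0, engines := ["harvest-1 GEN-22 e1:j098414-j098439", "e2:j098904-j098909"] }] := by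
  decide

end Summit.BirchSwinnertonDyer.Rank1Residual.PrintX8
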